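import Summits.FinalStateConjecture.FinalStateConjecture.Theorems.SwallowTheDatumKerrShieldedSettlesStubScriTransportAuxLift
import Summits.FinalStateConjecture.FinalStateConjecture.Theorems.SwallowTheDatumKerrShieldedSettlesStubScriTransportAuxCap
import Summits.FinalStateConjecture.FinalStateConjecture.Statement
import Literature.Geometry.Lorentzian.NullInfinity
import HarnessLib

/-!
# `KerrShieldedSettles`, line `tapered-temporal-collar` — stub S5 `stub_scriTransport` (clause (a):
# complete future null infinity of every vacuum development containing the tapered collar)

Crux `stmt-FinalStateConjecture-10054`
(`Summit.FinalStateConjecture.FinalStateConjecture.Theses.SwallowTheDatum.KerrShieldedSettles`), registered stub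
`stub_scriTransport`: **the Kerr-side sojourn estimate (stub S4) transports through the chart map `χ` of the
collar into any vacuum Cauchy development `𝒟` of an admissible shielded datum, giving
`Summit.FinalStateConjecture.HasCompleteNullInfinity 𝒟`** — Christodoulou's intrinsic completeness of `𝓘⁺` in
the sojourn form of `NullInfinity.lean`.

The three engines are in the support files: part 1 (`…StubScriTransportAux`: geodesics of two charts with the
same components, the causal `u`-clock, `J⁺` through a locally good map, the differential of `χ`), part 2
(`…AuxCap`: inner-edge capping `X ∖ φ({r > R})` compact — the only place where admissibility is used,
Disproof.lean §H1), part 3 (`…AuxLift`: maximal null rays of `𝒟` from the leaf are images of maximal chart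
geodesics on `dom_K ∩ [0, ∞)`).  This file is the bookkeeping of `B₀`, `B₁`, the normalisation
`g_K(γ_K' 0, ν y) = g_𝒟(γ' 0, ν_𝒟(φ y)) = −1`, and the monotonicity of the sojourn time.

References: D. Christodoulou, CQG 16 (1999) A23, pp. A26–A27; M. Dafermos, I. Rodnianski, arXiv:0811.0354,
§2.6.2 and §5.1; B. O'Neill, *Semi-Riemannian geometry* (1983), Ch. 3, pp. 90–91, Ch. 14, pp. 402–403.
-/

set_option linter.dupNamespace false

noncomputable section

open Set Filter Function
open scoped Manifold ContDiff Topology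
open Literature.Geometry.Lorentzian
open Summit.FinalStateConjecture.FinalStateConjecture.Theorems.KerrShieldedDataExist.Negative
  (bentHeight graph psi_eq_graph mass_pos)

namespace Summit.FinalStateConjecture.FinalStateConjecture.Theorems.SwallowTheDatum.KerrShieldedSettles

open ScriTransport CollarEmbedsMGHD in
set_option linter.unusedVariables false in
/-- **S5 `stub_scriTransport` — complete future null infinity of every vacuum Cauchy development containing the
tapered collar** (clause (a) of crux `KerrShieldedSettles`, line `tapered-temporal-collar`).  For an ADMISSIBLE
shielded datum (`hD`; the shield: sub-extremal `(M, a)`, `r₋ < r₁ < r₊`, `φ : Kerr.slice a r₁ → X` a smooth open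
embedding with compact co-range, `ψ` the graph of `T = bentHeight M a`, normal field `ν`, pull-back identity
`h(dφ v, dφ w) = g_{M,a}(dψ v, dψ w)`), the Kerr-side sojourn estimate `hray` (stub S4: rays from leaf radius
`≥ R₁` are future complete in the chart or sojourn `≥ s` in `J⁺_K(ψ{r ≤ R₀})`), ANY vacuum Cauchy development
`𝒟` of `D` and a chart map `χ` which on the collar `W = {0 < x⁰ − T(r) + (r − r₁)/4}` is smooth, an open
embedding, isometric and oriented, with `χ ∘ ψ = ι ∘ φ`, `dχ ν = ν_𝒟 ∘ φ`:
`𝒟` has complete future null infinity in Christodoulou's sojourn form.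
Proof: `B₀ := X ∖ φ({r > R₀})`, `B₁ := X ∖ φ({r > max R₁ (4M + 1)})` are compact (inner-edge capping from
admissibility, part 2 `isCompact_compl_image_far`); a normalised `𝒟`-ray `γ : dom` from `ι(φ y) = χ(ψ y)`,
`r y > max R₁ (4M+1)`, is `χ ∘ γ_K` on `dom_K ∩ [0, ∞) ⊆ dom` for the maximal chart geodesic `γ_K` with the
pulled-back data (part 3 `ray_lift`), which is a normalised null ray of the chart from `y` (`dχ` is an oriented
linear isometry on `W`, `dχ ν = ν_𝒟`); by `hray` either `[0, ∞) ⊆ dom_K ⊆ dom` (future complete) or the chart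
sojourn is `≥ s`, and `χ(J⁺_K(ψ{r ≤ R₀})) ⊆ J⁺_𝒟(ι B₀)` because the connecting causal chart curves start on the
leaf and stay in `W` by the causal `u`-clock (part 1 `image_causalFuture_subset`, `curve_mem_collar`), while
`χ(ψ y') = ι(φ y') ∈ ι B₀` for `r y' ≤ R₀` (`sojournTime` is monotone).  Christodoulou, CQG 16 (1999) A23,
pp. A26–A27; Dafermos–Rodnianski arXiv:0811.0354, §2.6.2, §5.1; O'Neill 1983, Ch. 3, pp. 90–91.
[cite: arXiv08110354, §2.6.2] -/
theorem stub_scriTransport : ∀ [Kerr.Facts] (X : Type) [TopologicalSpace X]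
    [ChartedSpace E3 X] [IsManifold (𝓡 3) ((⊤ : ℕ∞) : WithTop ℕ∞) X] [T2Space X]
    [SecondCountableTopology X] [ConnectedSpace X] (D : InitialDataSet (𝓡 3) X),
    D ∈ admissibleVacuumData X →
    ∀ (M a r₁ : ℝ) (hM : 0 ≤ M) (φ : Kerr.slice a r₁ → X)
    (ψ : Kerr.slice a r₁ → Kerr.region a r₁) (ν : NormalField 𝓘(ℝ, E4) ψ),
    |a| < M → Kerr.rMinus M a < r₁ → r₁ < Kerr.rPlus M a →
    IsCompact (Set.range φ)ᶜ → Topology.IsOpenEmbedding φ →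
    ContMDiff 𝓘(ℝ, E3) (𝓡 3) ((⊤ : ℕ∞) : WithTop ℕ∞) φ →
    (∀ y : Kerr.slice a r₁, (ψ y : E4) =
        E4.ofTimeSpace (bentHeight M a (Kerr.radius a (E4.ofTimeSpace 0 (y : E3)))) (y : E3)) →
    (∀ (y : Kerr.slice a r₁) (v w : E3),
        D.h.inner (φ y) (mfderiv 𝓘(ℝ, E3) (𝓡 3) φ y v) (mfderiv 𝓘(ℝ, E3) (𝓡 3) φ y w) =
          Kerr.bilin M a (ψ y : E4) (mfderiv 𝓘(ℝ, E3) 𝓘(ℝ, E4) ψ y v)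
            (mfderiv 𝓘(ℝ, E3) 𝓘(ℝ, E4) ψ y w)) →
    (∀ [(Kerr.smoothMetric M a r₁).HasLeviCivita],
      ∃ R₀ : ℝ, ∀ s : ℝ, 0 < s → ∃ R₁ : ℝ, ∀ y : Kerr.slice a r₁,
        R₁ ≤ Kerr.radius a (E4.ofTimeSpace 0 (y : E3)) →
        ∀ (γ : ℝ → Kerr.region a r₁) (dom : Set ℝ),
          (Kerr.smoothMetric M a r₁).IsNormalisedNullRayFrom
              ((Kerr.timeOrientation M a r₁ hM).ofLE le_top) ψ ν y γ dom →
          Set.Ici (0 : ℝ) ⊆ dom ∨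
            ENNReal.ofReal s ≤ sojournTime γ dom
              ((Kerr.smoothMetric M a r₁).causalFuture ((Kerr.timeOrientation M a r₁ hM).ofLE le_top)
                (ψ '' {y' : Kerr.slice a r₁ | Kerr.radius a (E4.ofTimeSpace 0 (y' : E3)) ≤ R₀}))) →
    ∀ (𝒟 : VacuumCauchyDevelopment D) (χ : Kerr.region a r₁ → 𝒟.carrier),
      ContMDiffOn 𝓘(ℝ, E4) (𝓡 4) ((⊤ : ℕ∞) : WithTop ℕ∞) χ
          {x | 0 < (x : E4) 0 - bentHeight M a (Kerr.radius a (x : E4)) +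
            (Kerr.radius a (x : E4) - r₁) / 4} →
      Topology.IsOpenEmbedding (Set.restrict {x : Kerr.region a r₁ |
          0 < (x : E4) 0 - bentHeight M a (Kerr.radius a (x : E4)) +
            (Kerr.radius a (x : E4) - r₁) / 4} χ) →
      (∀ x : Kerr.region a r₁, 0 < (x : E4) 0 - bentHeight M a (Kerr.radius a (x : E4)) +
            (Kerr.radius a (x : E4) - r₁) / 4 →
          (∀ v w : E4, 𝒟.metric.val (χ x) (mfderiv 𝓘(ℝ, E4) (𝓡 4) χ x v)
              (mfderiv 𝓘(ℝ, E4) (𝓡 4) χ x w) = Kerr.bilin M a (x : E4) v w) ∧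
          𝒟.metric.val (χ x) (𝒟.timeOrientation.vectorField (χ x))
              (mfderiv 𝓘(ℝ, E4) (𝓡 4) χ x (Kerr.timeVector M a (x : E4))) < 0) →
      (∀ y : Kerr.slice a r₁, χ (ψ y) = 𝒟.embed (φ y)) →
      (∀ y : Kerr.slice a r₁, mfderiv 𝓘(ℝ, E4) (𝓡 4) χ (ψ y) (ν y) = 𝒟.normal (φ y)) →
      Summit.FinalStateConjecture.HasCompleteNullInfinity 𝒟.toCauchyDevelopment := by
  intro _ X _ _ _ _ _ _ D hD M a r₁ hM φ ψ ν ha hr₁ hr₂ hK hφo hφs hψ hh hray 𝒟 χ hχs hχe hχg hχψ hχν inst𝒟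
  haveI : (Kerr.smoothMetric M a r₁).HasLeviCivita :=
    (Kerr.smoothMetric M a r₁).toPseudoRiemannianMetric.hasLeviCivita
  obtain rfl : ψ = graph M a r₁ := psi_eq_graph rfl hψ
  have hM0 : 0 < M := mass_pos ha
  obtain ⟨R₀, hR₀⟩ := hray
  -- notation
  set τK : TimeOrientation (Kerr.smoothMetric M a r₁) := (Kerr.timeOrientation M a r₁ hM).ofLE le_top with hτK
  set S₀ : Set (Kerr.slice a r₁) := {y' | Kerr.radius a (E4.ofTimeSpace 0 (y' : E3)) ≤ R₀} with hS₀
  set B₀ : Set X := (φ '' {y : Kerr.slice a r₁ | R₀ < Kerr.radius a (E4.ofTimeSpace 0 (y : E3))})ᶜ with hB₀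
  have hcap := isCompact_compl_image_far hD ha hr₁ hr₂ hK hφo hφs hh
  -- leaf points of radius `≤ R₀` are mapped into `B₀`
  have hB₀mem : ∀ y' ∈ S₀, φ y' ∈ B₀ := by
    rintro y' hy' ⟨y'', hy'', he⟩
    have : y'' = y' := hφo.injective he
    subst this
    exact absurd (show R₀ < _ from hy'') (not_lt.2 hy')
  -- `χ` pushes the chart causal future of the leaf piece into the causal future of `ι B₀`
  have hpush : χ '' (Kerr.smoothMetric M a r₁).causalFuture τK (graph M a r₁ '' S₀) ⊆
      𝒟.metric.causalFuture 𝒟.timeOrientation (𝒟.embed '' B₀) := by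
    refine (image_causalFuture_subset (τN := τK) (τ := 𝒟.timeOrientation) (f := χ)
      (O := {x : Kerr.region a r₁ | 0 < (x : E4) 0 - bentHeight M a (Kerr.radius a (x : E4)) +
        (Kerr.radius a (x : E4) - r₁) / 4}) (S := graph M a r₁ '' S₀) (fun x hx ↦ ⟨?_, fun v hv ↦ ?_⟩) ?_).trans
      (LorentzianMetric.causalFuture_mono ?_)
    · exact ((hχs x hx).contMDiffAt ((collar M a r₁ hM0).isOpen.mem_nhds hx)).mdifferentiableAt (by simp)
    · exact isFutureDirected_mfderiv_of_iso hM (hχg x hx).1 (hχg x hx).2 hv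
    · rintro c b₁ b₂ hb hc ⟨y', -, hy'⟩ t ht
      refine curve_mem_collar ha ordConnected_Icc hc (left_mem_Icc.2 hb.le) ?_ ht ht.1
      rw [← hy', radius_graph, graph_apply_zero]
    · rintro _ ⟨_, ⟨y', hy', rfl⟩, rfl⟩
      exact ⟨φ y', hB₀mem y' hy', (hχψ y').symm⟩
  refine ⟨B₀, hcap R₀, fun s hs ↦ ?_⟩
  obtain ⟨R₁, hR₁⟩ := hR₀ s hs
  set R₁' : ℝ := max R₁ (4 * M + 1) with hR₁'
  refine ⟨(φ '' {y : Kerr.slice a r₁ | R₁' < Kerr.radius a (E4.ofTimeSpace 0 (y : E3))})ᶜ, hcap R₁',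
    fun p hp γ dom hγ ↦ ?_⟩
  obtain ⟨y, hy, rfl⟩ : p ∈ φ '' {y : Kerr.slice a r₁ | R₁' < Kerr.radius a (E4.ofTimeSpace 0 (y : E3))} :=
    not_notMem.1 hp
  have hy₁ : R₁ ≤ Kerr.radius a (E4.ofTimeSpace 0 (y : E3)) := (le_max_left _ _).trans hy.le
  have hy₄ : 4 * M < Kerr.radius a (graph M a r₁ y : E4) := by
    rw [radius_graph]; exact lt_of_lt_of_le (by linarith [le_max_right R₁ (4 * M + 1)]) hy.le
  -- lift the ray to the chart
  have hx0 : χ (graph M a r₁ y) = γ 0 := (hχψ y).trans hγ.apply_zero.symm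
  obtain ⟨γK, domK, hmaxK, h0K, hγK0, hvel, hnullK, hfdK, hagree⟩ :=
    ray_lift hM0 hM ha hχs hχg (x₀ := graph M a r₁ y) (by rw [radius_graph, graph_apply_zero]) hy₄
      hγ.isMaximalGeodesicOn hγ.zero_mem hx0 hγ.isNull_velocity hγ.isFutureDirected_velocity
  -- it is a normalised null ray of the chart from `y`
  have hnorm : (Kerr.smoothMetric M a r₁).val (graph M a r₁ y) (velocity 𝓘(ℝ, E4) γK 0) (ν y) = -1 := by
    have hW := graph_mem_collar hM0 y
    rw [mem_collar] at hW
    have h1 := (hχg _ hW).1 (velocity 𝓘(ℝ, E4) γK 0) (ν y)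
    rw [hvel, hχν y] at h1
    have key : ∀ (q : 𝒟.carrier) (_ : q = 𝒟.embed (φ y)),
        𝒟.metric.val q (show TangentSpace (𝓡 4) q from velocity (𝓡 4) γ 0)
          (show TangentSpace (𝓡 4) q from 𝒟.normal (φ y)) = -1 := by
      rintro q rfl; exact hγ.val_velocity_normal
    exact h1.symm.trans (key _ (hχψ y))
  have hγK : (Kerr.smoothMetric M a r₁).IsNormalisedNullRayFrom τK (graph M a r₁) ν y γK domK :=
    ⟨hmaxK, h0K, hγK0, hnullK, hfdK, hnorm⟩
  rcases hR₁ y hy₁ γK domK hγK with h | h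
  · refine Or.inl fun hb ↦ ?_
    have : Ici (0 : ℝ) ⊆ dom := fun t ht ↦ (hagree t (h ht) ht).1
    exact not_bddAbove_Ici (a := (0 : ℝ)) (hb.mono this)
  · refine Or.inr (h.trans (MeasureTheory.measure_mono fun t ht ↦ ?_))
    obtain ⟨htK, ht0, hJt⟩ := ht
    obtain ⟨htdom, heq⟩ := hagree t htK ht0
    refine ⟨htdom, ht0, ?_⟩
    rw [← heq]
    exact hpush (mem_image_of_mem χ hJt)


end Summit.FinalStateConjecture.FinalStateConjecture.Theorems.SwallowTheDatum.KerrShieldedSettles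

end
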